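/-
Copyright (c) 2026 the pub-hodgecm-mathlib formalisation cell (harness21).  Prover seat hodgecm-mathlib-K2E4-p10 (g5), Track B ∕ K2-LIT, h413 =
`stmt-HodgeConjecture-24833`, ENGINE E1, campaign «EIS-WHITTAKER-3», WAVE 2 rung W3₃ (dealer K2E1-plan (g5) RE-KEY 2026-09-04T08:17:33Z; (γ) WIRING
`K2/K2E1b-plan/g6/WIRING-W5-FINAL-EisWhittaker3.K2E1b-plan-g6.md` 62273ccaa0f78706 §1 row W3₃; W0₃ CONVENTIONS 2fdd2f7063acaab9 §4 (ii)(ii′), §6), FILE A of the cut proposed 08:20Z: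
the REGROUPING of the finite Whittaker Euler product off `S_ξ` against the denominator `D^S(z) = ζ^S_L(z)·L^S(2z−1, ω)` of ★ p858416, and the hypothesis-first assembly head.
-/
import Summits.HodgeConjecture.HodgeConjecture.Theorems.K2E1IntertwiningScalarContinuationU3   -- ★ p858416 (K2E2-p12 g5): `hasProd_den`, `den_ne_zero`, `differentiableOn_den`; CM frame `quadraticHeckeCharCM` unitary
import Summits.HodgeConjecture.HodgeConjecture.Theorems.K2E1AdelicFourierCoeffEulerProduct      -- ★ W3-engine (K2E3-p12 g6): template of §4 `hasProd_mul_inv_partialZeta_of_eq_off` (`HasProd.mul_compl` regrouping)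
import HarnessLib

/-!
# K2·E1 — `K2E1WhittakerCoefficientEulerProductU3` (W3₃, FILE A): REGROUPING THE FINITE WHITTAKER EULER PRODUCT OF `U(2,1)_{L∕L⁺}` OFF `S_ξ` —
# `∏'_v W_v(ξ, z) = (∏_{v ∈ S_ξ} W_v(ξ, z)) · [ζ^{S_ξ}_{L⁺}(z)·L^{S_ξ}(z, ε)·L^{S_ξ}(2z−1, ε)]⁻¹ = (∏_{v∈S_ξ} W_v)·[ζ^{S_ξ}_L(z)·L^{S_ξ}(2z−1, ε_{L∕L⁺})]⁻¹` ON `Re z > 1`, AND THE ASSEMBLY HEAD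

Track B ∕ K2-LIT, crux h413 = `stmt-HodgeConjecture-24833`, route of record `HCCMUnconditional`; cell `hodgecm-mathlib`, squad K2, ENGINE E1 (campaign «EIS-WHITTAKER-3», WAVE 2).
Prover seat `hodgecm-mathlib-K2E4-p10` (g5).  THEOREMS ONLY (no `def`, no `instance`, no notation, no named-fact hypothesis, no `sorry`; default heartbeats); lane
`--supports stmt-HodgeConjecture-24833 --as helper` (count-neutral).  Closes no socket.

THE MATHEMATICS [TateThesis1967, Thm 3.3.1, §4.1; Bump1997, §3.7; Garrett2018, §1.10, §2.8; Rogawski1990, §4.5 p. 45].  The abelian Whittaker coefficient of the spherical flat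
section `H^z` of `U(J₃) = U(2,1)` over the CM pair `(F, E) = (L⁺, L)` is, at `g = k ∈ K_U` and `2 < Re z`, `μE(D_E)⁻¹·𝓕_E[Φ^Z_k](ξ) = κ · W_∞(ξ, z) · ∏'_{v fin} W_v(ξ, z)` (W0₃ §1 (W)),
an Euler product over the finite places `v` OF `F` (a split pair `v = w w̄` couples `X_w, X_w̄`).  Off the finite set `S_ξ` (W0₃ §6) the local factors are the UNIT VALUES
  `W_v(ξ, z) = (1 − q_v^{−z})·(1 − ε_v q_v^{−z})·(1 − ε_v q_v^{−(2z−1)})`,  `ε = ε_{L∕L⁺}` (★ `quadraticHeckeCharCM L`), `ε_v = ε(ϖ_v) = ∓1`: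
inert (`ε_v = −1`): `(1 − q_v^{−2z})(1 + q_v^{−(2z−1)})` = ★ D-W1 `K2E1FiniteWhittakerInertU3.integral_inertWhittaker_eq_localDen`; split (`ε_v = +1`): `(1 − q_v^{−z})²(1 − q_v^{−(2z−1)})`
= D-W4 «W2₃-fin-split».  These are VERBATIM the local factors of the denominator `D^S(z) := ζ^S_F(z)·L^S(z, ε)·L^S(2z−1, ε)` of ★ p858416 `K2E1IntertwiningScalarContinuationU3.hasProd_den`
(`= ζ^S_L(z)·L^S(2z−1, ε_{L∕L⁺})`: `ζ_{L,w}(z)⁻¹ = (1−q_v^{−z})(1−ε_v q_v^{−z})`), an absolutely convergent, holomorphic, zero-free Euler product on the OPEN WINDOW `Re z > 1` (★ `den_ne_zero`,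
★ `differentiableOn_den`) — NO continuation of `ζ_L` or `L(·, ε)` is needed there (CENSUS (α) §2 verdict).  Hence (Mathlib `HasProd.mul_compl`, the device of ★ W3-engine §4 at N = 2):
  **`∏'_v W_v(ξ, z) = (∏_{v ∈ S_ξ} W_v(ξ, z)) · D^{S_ξ}(z)⁻¹`**, and the Whittaker coefficient is `κ·W_∞·(∏_{S_ξ} W_v)·D^{S_ξ}(z)⁻¹` — entire local factors × `1∕D^{S_ξ}` (holomorphic on
`Re z > 1`): the form W4₃ (= ★ W4 with `K := L`) ∕ W-hWbd₃ ∕ W5₃-A consume.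

THE LEAN TEXT (generic number field `F`, unitary Hecke character `ε`, then the CM frame).
* §1 **`hasProd_unitDen_inv`** — `HasProd (v ∉ S ↦ (1 − q_v^{−z})(1 − ε_v q_v^{−z})(1 − ε_v q_v^{−(2z−1)})) D^S(z)⁻¹ ∧ D^S(z) ≠ 0` (`1 < Re z`; ★ `hasProd_den` inverted through
  `Tendsto.inv₀`); **`differentiableOn_den_inv`** — `z ↦ D^S(z)⁻¹` holomorphic on `{1 < Re z}`.
* §2 **`hasProd_mul_inv_den_of_eq_off`** — for `W : places(F) → ℂ`, a finset `S`, `1 < Re z` and the NAMED unit values `hW : ∀ v ∉ S, W v = (1 − q_v^{−z})(1 − ε_v q_v^{−z})(1 − ε_v q_v^{−(2z−1)})`: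
  `HasProd W ((∏_{v∈S} W v) · D^S(z)⁻¹) ∧ D^S(z) ≠ 0`; `tprod_eq_prod_mul_inv_den_of_eq_off` (the `∏'` form).
* §3 **`eq_mul_prod_mul_inv_den_of_hasProd`** — THE HYPOTHESIS-FIRST ASSEMBLY HEAD: from a splitting `Λ = c · A · I` (letters: `Λ` = `μE(D_E)⁻¹𝓕_E[Φ^Z_k](ξ)`, `c` = the measure
  constant, `A` = the archimedean integral, `I` = the normalised finite integral — FILE B discharges it from ★ (a2)₃ :321 + ★ W3-engine :108 + ★ p858520 + (q10) FILE 3's transport),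
  an Euler product `HasProd W I` (★ `AdelicProductIntegral.hasProd_localIntegral_of_integrable`, ι = Fin 3) and the unit values `hW`:  `Λ = c · A · ((∏_{v∈S} W v) · D^S(z)⁻¹)`.
* §4 THE CM FRAME `F = L⁺`, `ε = quadraticHeckeCharCM L` (unitary: finite order ★ `isFiniteOrder_quadraticHeckeCharCM`): `hasProd_unitDen_inv_cm`, `hasProd_mul_inv_den_of_eq_off_cm`,
  `whittakerCoeff_eq_prod_of_inputs` (the dealer's head name, 08:20:45Z), `differentiableOn_den_inv_cm` — hypothesis `hε` discharged.
HONEST LABEL: HC_CM is proved only modulo the 7 printed citations (2 remaining named inputs: hLiu418 = `stmt-HodgeConjecture-24832`, h413 = `stmt-HodgeConjecture-24833`) until rung 0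
closes; this file asserts no named fact and closes no socket; §3 is CONDITIONAL BY CONSTRUCTION on the letters `hsplit hprod hW` (payers: FILE B ∕ (q10) FILE 3 transport; D-W1 ★, D-W4);
count-neutral.

## References
* [TateThesis1967] J. Tate, *Fourier analysis in number fields and Hecke's zeta-functions*, in Cassels–Fröhlich (1967), Ch. XV: Thm 3.3.1, §4.1.
* [Bump1997] D. Bump, *Automorphic Forms and Representations* (1997): §3.7.
* [Garrett2018] P. Garrett, *Modern Analysis of Automorphic Forms by Example* 1 (2018): §1.10, §2.8.
* [Rogawski1990] J. D. Rogawski, *Automorphic Representations of Unitary Groups in Three Variables* (1990): §4.5 p. 45.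
* [NeukirchANT1999] J. Neukirch, *Algebraic Number Theory* (1999): Ch. VII (5.2) (Euler products of Hecke `L`-series).
-/

set_option autoImplicit false
set_option linter.dupNamespace false -- the mandated namespace repeats `HodgeConjecture.HodgeConjecture`

noncomputable section

open scoped NNReal
open Filter Topology NumberField IsDedekindDomain
open Literature.NumberTheory.Automorphic Literature.NumberTheory.LFunctions Literature.NumberTheory.GaloisRepresentations
open Summit.HodgeConjecture.HodgeConjecture.Cruxes.H413.K2E1IntertwiningScalarContinuationU3 (hasProd_den den_ne_zero differentiableOn_den)

namespace Summit.HodgeConjecture.HodgeConjecture.Cruxes.H413.K2E1WhittakerCoefficientEulerProductU3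

section General

variable {F : Type} [Field F] [NumberField F] {ε : HeckeCharacter F}

/-! ## §1 The inverted denominator `∏_{v∉S} (1 − q_v^{−z})(1 − ε_v q_v^{−z})(1 − ε_v q_v^{−(2z−1)}) = D^S(z)⁻¹` on `Re z > 1` -/

/-- **THE UNIT VALUES MULTIPLY TO `D^S(z)⁻¹`** (`ε` unitary, `S` any set of finite places, `1 < Re z`):
`HasProd (v ∉ S ↦ (1 − q_v^{−z})(1 − ε_v q_v^{−z})(1 − ε_v q_v^{−(2z−1)})) [ζ^S_F(z)·L^S(z,ε)·L^S(2z−1,ε)]⁻¹` and the bracket is `≠ 0` — ★ `hasProd_den` (the Euler product of the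
INVERSE local factors) inverted through `Tendsto.inv₀` on the partial products (the device of ★ W3-engine `hasProd_one_sub_residueCard_cpow`). [cite: NeukirchANT1999, Ch. VII (5.2)] [cite: TateThesis1967, §4.1] -/
theorem hasProd_unitDen_inv (hε : ε.IsUnitary) (S : Set (HeightOneSpectrum (𝓞 F))) {z : ℂ} (hz : 1 < z.re) :
    HasProd (fun v : {v : HeightOneSpectrum (𝓞 F) // v ∉ S} =>
        (1 - (v.1.residueCard : ℂ) ^ (-z)) * (1 - ε.valueAtUniformizer v.1 * (v.1.residueCard : ℂ) ^ (-z)) *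
          (1 - ε.valueAtUniformizer v.1 * (v.1.residueCard : ℂ) ^ (-(2 * z - 1))))
      (partialStandardL S (fun _ => {1}) z * partialStandardL S (fun v => {ε.valueAtUniformizer v}) z *
        partialStandardL S (fun v => {ε.valueAtUniformizer v}) (2 * z - 1))⁻¹ ∧
    partialStandardL S (fun _ => {1}) z * partialStandardL S (fun v => {ε.valueAtUniformizer v}) z *
        partialStandardL S (fun v => {ε.valueAtUniformizer v}) (2 * z - 1) ≠ 0 := by
  obtain ⟨h, hne⟩ := hasProd_den (S := S) hε hz
  refine ⟨?_, hne⟩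
  unfold HasProd at h ⊢
  have hi := h.inv₀ hne
  simp only [← Finset.prod_inv_distrib, mul_inv, inv_inv] at hi
  rw [mul_inv, mul_inv]
  exact hi

/-- **`z ↦ D^S(z)⁻¹` IS HOLOMORPHIC ON `{1 < Re z}`** (★ `differentiableOn_den`, ★ `den_ne_zero`) — the normalising factor of the Whittaker coefficient seen by W4₃ ∕ W-hWbd₃ ∕ W5₃-A.
[cite: NeukirchANT1999, Ch. VII (5.2)] -/
theorem differentiableOn_den_inv (hε : ε.IsUnitary) (S : Set (HeightOneSpectrum (𝓞 F))) :
    DifferentiableOn ℂ (fun z : ℂ =>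
      (partialStandardL S (fun _ => {1}) z * partialStandardL S (fun v => {ε.valueAtUniformizer v}) z *
        partialStandardL S (fun v => {ε.valueAtUniformizer v}) (2 * z - 1))⁻¹) {z : ℂ | 1 < z.re} :=
  (differentiableOn_den (S := S) hε).inv fun _ hz => den_ne_zero (S := S) hε hz

/-! ## §2 Regrouping an Euler product with the unit values off a finite set `S` -/

/-- **REGROUPING OFF A FINITE SET.**  If `W_v = (1 − q_v^{−z})(1 − ε_v q_v^{−z})(1 − ε_v q_v^{−(2z−1)})` for every `v ∉ S` (`S` a finset; the unit values of W2₃-fin-inert ★ `…_eq_localDen`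
(`ε_v = −1`) and W2₃-fin-split (`ε_v = +1`), taken as the NAMED input `hW`) and `1 < Re z`, then **`HasProd W ((∏_{v∈S} W_v) · D^S(z)⁻¹)`** with `D^S(z) ≠ 0` — the whole finite
Euler product is a FINITE product of (entire) local factors times `1∕[ζ^S_F(z)·L^S(z,ε)·L^S(2z−1,ε)]` (Mathlib `HasProd.mul_compl`; twin of ★ W3-engine
`hasProd_mul_inv_partialZeta_of_eq_off`). [cite: Bump1997, §3.7] [cite: Garrett2018, §1.10] [cite: TateThesis1967, Thm 3.3.1] -/
theorem hasProd_mul_inv_den_of_eq_off (hε : ε.IsUnitary) {W : HeightOneSpectrum (𝓞 F) → ℂ} (S : Finset (HeightOneSpectrum (𝓞 F))) {z : ℂ} (hz : 1 < z.re)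
    (hW : ∀ v ∉ S, W v = (1 - (v.residueCard : ℂ) ^ (-z)) * (1 - ε.valueAtUniformizer v * (v.residueCard : ℂ) ^ (-z)) *
      (1 - ε.valueAtUniformizer v * (v.residueCard : ℂ) ^ (-(2 * z - 1)))) :
    HasProd W ((∏ v ∈ S, W v) *
      (partialStandardL (S : Set (HeightOneSpectrum (𝓞 F))) (fun _ => {1}) z *
        partialStandardL (S : Set (HeightOneSpectrum (𝓞 F))) (fun v => {ε.valueAtUniformizer v}) z *
        partialStandardL (S : Set (HeightOneSpectrum (𝓞 F))) (fun v => {ε.valueAtUniformizer v}) (2 * z - 1))⁻¹) ∧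
    partialStandardL (S : Set (HeightOneSpectrum (𝓞 F))) (fun _ => {1}) z *
        partialStandardL (S : Set (HeightOneSpectrum (𝓞 F))) (fun v => {ε.valueAtUniformizer v}) z *
        partialStandardL (S : Set (HeightOneSpectrum (𝓞 F))) (fun v => {ε.valueAtUniformizer v}) (2 * z - 1) ≠ 0 := by
  obtain ⟨h, hne⟩ := hasProd_unitDen_inv hε (S : Set (HeightOneSpectrum (𝓞 F))) hz
  refine ⟨HasProd.mul_compl (s := (S : Set (HeightOneSpectrum (𝓞 F)))) ?_ ?_, hne⟩
  · have hf := hasProd_fintype (W ∘ (↑) : (↑S : Set (HeightOneSpectrum (𝓞 F))) → ℂ)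
    rwa [show (∏ b : (↑S : Set (HeightOneSpectrum (𝓞 F))), (W ∘ (↑)) b) = ∏ v ∈ S, W v from Finset.prod_coe_sort S W] at hf
  · exact h.congr_fun fun v => hW v.1 fun hv => v.2 (Finset.mem_coe.2 hv)

/-- The `∏'` form: `∏'_v W_v = (∏_{v∈S} W_v) · D^S(z)⁻¹` and `W` is multipliable. [cite: Bump1997, §3.7] [cite: TateThesis1967, Thm 3.3.1] -/
theorem tprod_eq_prod_mul_inv_den_of_eq_off (hε : ε.IsUnitary) {W : HeightOneSpectrum (𝓞 F) → ℂ} (S : Finset (HeightOneSpectrum (𝓞 F))) {z : ℂ} (hz : 1 < z.re)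
    (hW : ∀ v ∉ S, W v = (1 - (v.residueCard : ℂ) ^ (-z)) * (1 - ε.valueAtUniformizer v * (v.residueCard : ℂ) ^ (-z)) *
      (1 - ε.valueAtUniformizer v * (v.residueCard : ℂ) ^ (-(2 * z - 1)))) :
    Multipliable W ∧
    ∏' v, W v = (∏ v ∈ S, W v) *
      (partialStandardL (S : Set (HeightOneSpectrum (𝓞 F))) (fun _ => {1}) z *
        partialStandardL (S : Set (HeightOneSpectrum (𝓞 F))) (fun v => {ε.valueAtUniformizer v}) z *
        partialStandardL (S : Set (HeightOneSpectrum (𝓞 F))) (fun v => {ε.valueAtUniformizer v}) (2 * z - 1))⁻¹ :=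
  have h := (hasProd_mul_inv_den_of_eq_off hε S hz hW).1
  ⟨h.multipliable, h.tprod_eq⟩

/-! ## §3 The hypothesis-first assembly head -/

/-- **W3₃ ASSEMBLY, HYPOTHESIS-FIRST.**  Letters: `Λ` (the normalised Whittaker coefficient `μE(D_E)⁻¹·𝓕_E[Φ^Z_k](ξ)`), `c` (the global measure constant, W0₃ §1∕§6), `A` (the
archimedean integral `∫_{mixedSpace L} Ψ_∞(S)·𝐞(−Tr(ξS)) dS`, left unevaluated until W2₃-arch), `I` (the normalised finite integral over `𝔸_{L⁺,f}³` after the `{1,δ}` transport),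
`W` (the local Whittaker factors).  From the SPLITTING `hsplit : Λ = c·A·I` (★ W3-engine `adeleFourierCoeff_map_split_eq_mul` at `K := L` + ★ p858520 + (q10) FILE 3's local measure
change — FILE B), the EULER PRODUCT `hprod : HasProd W I` (★ `AdelicProductIntegral.hasProd_localIntegral_of_integrable`, ι = Fin 3, under the joint-`L¹` letter) and the UNIT VALUES
`hW` off `S` (★ D-W1 ∕ D-W4), on `1 < Re z`:  **`Λ = c · A · ((∏_{v∈S} W_v) · D^S(z)⁻¹)`** (`HasProd.unique`; the N = 2 twin is ★ p858393 §4).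
[cite: TateThesis1967, Thm 3.3.1 and §4.1] [cite: Bump1997, §3.7] [cite: Rogawski1990, §4.5 p. 45] -/
theorem eq_mul_prod_mul_inv_den_of_hasProd (hε : ε.IsUnitary) {Λ c A I : ℂ} {W : HeightOneSpectrum (𝓞 F) → ℂ} (S : Finset (HeightOneSpectrum (𝓞 F)))
    {z : ℂ} (hz : 1 < z.re) (hsplit : Λ = c * A * I) (hprod : HasProd W I)
    (hW : ∀ v ∉ S, W v = (1 - (v.residueCard : ℂ) ^ (-z)) * (1 - ε.valueAtUniformizer v * (v.residueCard : ℂ) ^ (-z)) *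
      (1 - ε.valueAtUniformizer v * (v.residueCard : ℂ) ^ (-(2 * z - 1)))) :
    Λ = c * A * ((∏ v ∈ S, W v) *
      (partialStandardL (S : Set (HeightOneSpectrum (𝓞 F))) (fun _ => {1}) z *
        partialStandardL (S : Set (HeightOneSpectrum (𝓞 F))) (fun v => {ε.valueAtUniformizer v}) z *
        partialStandardL (S : Set (HeightOneSpectrum (𝓞 F))) (fun v => {ε.valueAtUniformizer v}) (2 * z - 1))⁻¹) := by
  rw [hsplit, hprod.unique (hasProd_mul_inv_den_of_eq_off hε S hz hW).1]

end General

/-! ## §4 The CM frame: `F = L⁺`, `ε = ε_{L∕L⁺} = quadraticHeckeCharCM L` (unitary — finite order), hypothesis `hε` discharged -/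

section CM

variable (L : Type) [Field L] [NumberField L] [IsCMField L]

/-- `ε_{L∕L⁺}` is unitary (finite order, ★ `isFiniteOrder_quadraticHeckeCharCM`). [cite: NeukirchANT1999, Ch. VII (5.2)] -/
theorem isUnitary_quadraticHeckeCharCM : (quadraticHeckeCharCM L).IsUnitary :=
  (Literature.RepresentationTheory.HarrisKudlaSweet1996.isFiniteOrder_quadraticHeckeCharCM (L := L)).isUnitary

/-- **§1 AT THE CM FRAME**: `∏_{v∉S} (1 − q_v^{−z})(1 − ε_v q_v^{−z})(1 − ε_v q_v^{−(2z−1)}) = [ζ^S_{L⁺}(z)·L^S(z,ε_{L∕L⁺})·L^S(2z−1,ε_{L∕L⁺})]⁻¹ = [ζ^S_L(z)·L^S(2z−1, ε_{L∕L⁺})]⁻¹ ≠ 0⁻¹`,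
`1 < Re z` — the product of the Whittaker unit values (inert ★ D-W1 `_eq_localDen`, split D-W4). [cite: Rogawski1990, §4.5 p. 45] [cite: NeukirchANT1999, Ch. VII (5.2)] -/
theorem hasProd_unitDen_inv_cm (S : Set (HeightOneSpectrum (𝓞 ↥(maximalRealSubfield L)))) {z : ℂ} (hz : 1 < z.re) :
    HasProd (fun v : {v : HeightOneSpectrum (𝓞 ↥(maximalRealSubfield L)) // v ∉ S} =>
        (1 - (v.1.residueCard : ℂ) ^ (-z)) * (1 - (quadraticHeckeCharCM L).valueAtUniformizer v.1 * (v.1.residueCard : ℂ) ^ (-z)) *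
          (1 - (quadraticHeckeCharCM L).valueAtUniformizer v.1 * (v.1.residueCard : ℂ) ^ (-(2 * z - 1))))
      (partialStandardL S (fun _ => {1}) z * partialStandardL S (fun v => {(quadraticHeckeCharCM L).valueAtUniformizer v}) z *
        partialStandardL S (fun v => {(quadraticHeckeCharCM L).valueAtUniformizer v}) (2 * z - 1))⁻¹ ∧
    partialStandardL S (fun _ => {1}) z * partialStandardL S (fun v => {(quadraticHeckeCharCM L).valueAtUniformizer v}) z *
        partialStandardL S (fun v => {(quadraticHeckeCharCM L).valueAtUniformizer v}) (2 * z - 1) ≠ 0 :=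
  hasProd_unitDen_inv (isUnitary_quadraticHeckeCharCM L) S hz

/-- **§2 AT THE CM FRAME**: regrouping off a finset `S` with the named unit values. [cite: Bump1997, §3.7] [cite: Rogawski1990, §4.5 p. 45] -/
theorem hasProd_mul_inv_den_of_eq_off_cm {W : HeightOneSpectrum (𝓞 ↥(maximalRealSubfield L)) → ℂ} (S : Finset (HeightOneSpectrum (𝓞 ↥(maximalRealSubfield L))))
    {z : ℂ} (hz : 1 < z.re)
    (hW : ∀ v ∉ S, W v = (1 - (v.residueCard : ℂ) ^ (-z)) * (1 - (quadraticHeckeCharCM L).valueAtUniformizer v * (v.residueCard : ℂ) ^ (-z)) *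
      (1 - (quadraticHeckeCharCM L).valueAtUniformizer v * (v.residueCard : ℂ) ^ (-(2 * z - 1)))) :
    HasProd W ((∏ v ∈ S, W v) *
      (partialStandardL (S : Set (HeightOneSpectrum (𝓞 ↥(maximalRealSubfield L)))) (fun _ => {1}) z *
        partialStandardL (S : Set (HeightOneSpectrum (𝓞 ↥(maximalRealSubfield L)))) (fun v => {(quadraticHeckeCharCM L).valueAtUniformizer v}) z *
        partialStandardL (S : Set (HeightOneSpectrum (𝓞 ↥(maximalRealSubfield L)))) (fun v => {(quadraticHeckeCharCM L).valueAtUniformizer v}) (2 * z - 1))⁻¹) ∧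
    partialStandardL (S : Set (HeightOneSpectrum (𝓞 ↥(maximalRealSubfield L)))) (fun _ => {1}) z *
        partialStandardL (S : Set (HeightOneSpectrum (𝓞 ↥(maximalRealSubfield L)))) (fun v => {(quadraticHeckeCharCM L).valueAtUniformizer v}) z *
        partialStandardL (S : Set (HeightOneSpectrum (𝓞 ↥(maximalRealSubfield L)))) (fun v => {(quadraticHeckeCharCM L).valueAtUniformizer v}) (2 * z - 1) ≠ 0 :=
  hasProd_mul_inv_den_of_eq_off (isUnitary_quadraticHeckeCharCM L) S hz hW

/-- **§3 AT THE CM FRAME — THE W3₃ ASSEMBLY HEAD for `U(2,1)_{L∕L⁺}`**: `Λ = c·A·((∏_{v∈S} W_v)·[ζ^S_{L⁺}(z)L^S(z,ε)L^S(2z−1,ε)]⁻¹)` from `hsplit`, `hprod`, `hW` on `1 < Re z`.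
[cite: TateThesis1967, Thm 3.3.1 and §4.1] [cite: Rogawski1990, §4.5 p. 45] -/
theorem whittakerCoeff_eq_prod_of_inputs {Λ c A I : ℂ} {W : HeightOneSpectrum (𝓞 ↥(maximalRealSubfield L)) → ℂ}
    (S : Finset (HeightOneSpectrum (𝓞 ↥(maximalRealSubfield L)))) {z : ℂ} (hz : 1 < z.re) (hsplit : Λ = c * A * I) (hprod : HasProd W I)
    (hW : ∀ v ∉ S, W v = (1 - (v.residueCard : ℂ) ^ (-z)) * (1 - (quadraticHeckeCharCM L).valueAtUniformizer v * (v.residueCard : ℂ) ^ (-z)) *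
      (1 - (quadraticHeckeCharCM L).valueAtUniformizer v * (v.residueCard : ℂ) ^ (-(2 * z - 1)))) :
    Λ = c * A * ((∏ v ∈ S, W v) *
      (partialStandardL (S : Set (HeightOneSpectrum (𝓞 ↥(maximalRealSubfield L)))) (fun _ => {1}) z *
        partialStandardL (S : Set (HeightOneSpectrum (𝓞 ↥(maximalRealSubfield L)))) (fun v => {(quadraticHeckeCharCM L).valueAtUniformizer v}) z *
        partialStandardL (S : Set (HeightOneSpectrum (𝓞 ↥(maximalRealSubfield L)))) (fun v => {(quadraticHeckeCharCM L).valueAtUniformizer v}) (2 * z - 1))⁻¹) :=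
  eq_mul_prod_mul_inv_den_of_hasProd (isUnitary_quadraticHeckeCharCM L) S hz hsplit hprod hW

/-- `z ↦ D^S(z)⁻¹` at the CM frame is holomorphic on `{1 < Re z}`. [cite: NeukirchANT1999, Ch. VII (5.2)] -/
theorem differentiableOn_den_inv_cm (S : Set (HeightOneSpectrum (𝓞 ↥(maximalRealSubfield L)))) :
    DifferentiableOn ℂ (fun z : ℂ =>
      (partialStandardL S (fun _ => {1}) z * partialStandardL S (fun v => {(quadraticHeckeCharCM L).valueAtUniformizer v}) z *
        partialStandardL S (fun v => {(quadraticHeckeCharCM L).valueAtUniformizer v}) (2 * z - 1))⁻¹) {z : ℂ | 1 < z.re} :=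
  differentiableOn_den_inv (isUnitary_quadraticHeckeCharCM L) S

end CM

end Summit.HodgeConjecture.HodgeConjecture.Cruxes.H413.K2E1WhittakerCoefficientEulerProductU3

end
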